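import Summits.MatrixMultiplication.OmegaCensus.STPPAlignedDoubleKneserFilter

/-!
# ω-census (abelian STPP census): the N18 chain at COMPOSITE order — critical pairs from a numerically tight reading (kernel)

HONEST FRAMING (pub-omega census; verbatim): lottery ticket; floor = certified bounds/negative ranges.
Census STRUCTURE (seat pub-omega-stpp-2 gen 32, 2026-08-30), family (b2).  A necessary condition on STPP families in a finite abelian group of ARBITRARY
order `n` — the composite-order analogue of `STPPVosperTightStructure.lean` (which needs `n` prime); a tool for ANALYSING residual patterns, nothing
here is progress on `ω`.

## Statement

Setting of filter N18 (`STPPAlignedDoubleKneserFilter.lean`, `C`-reading): STPP family `(Aᵢ, Bᵢ, Cᵢ)_{i<N}` (CKSU 2005 Def. 5.1, the tree's `IsSTPP`) with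
non-empty sets in a finite abelian `H`, `|H| = n`, a block `i` and another block present; `a = |Aᵢ|`, `b = |Bᵢ|`, `vol = aᵢbᵢcᵢ`, `Y° = ⋃_{k≠i}(C_k − B_k)`
(`L = |Y°|`), `Z° = ⋃_{k≠i}(C_k − A_k)` (`z = |Z°|`), `S = −Aᵢ`, `W = {c − a − b}` (`|W| = vol`), `V = W ⊔ (S + Y°)`, and the inclusion `Bᵢ + V ⊆ H ∖ Z°`.
Kneser (census form `exists_dvd_kneserLB_le_card_add`) gives divisors `d, d′` of `n` with `kLB(a, L, d′) ≤ |S + Y°| =: t` and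
`kLB(b, vol + t, d) ≤ |Bᵢ + V| ≤ n − z`.

**Theorem (`critical_of_n18_tight`).**  If the DECIDABLE numeric side condition
`∀ d, d′ ∣ n, ∀ t ≤ n: kLB(a, L, d′) ≤ t → z + kLB(b, vol + t, d) ≤ n → (t = a + L − 1 ∧ z + kLB(b, vol + t, d) = n)`
holds (the reading is "N18-tight with every rescuing divisor pair forcing the critical values"), then
* `|(−Aᵢ) + Y°| = a + L − 1` — the INNER pair `(−Aᵢ, Y°)` is critical;
* `|V| = vol + a + L − 1` and `Bᵢ + V = H ∖ Z°` EXACTLY (`|Bᵢ + V| = n − z`) — the OUTER pair `(Bᵢ, V)` is critical onto the complement of `Z°`.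

At a prime `n = p` the side condition is the equality `z + b + vol + a + L − 2 = p` and the conclusion is the input of Vosper's theorem
(`vosper_structure_of_n18_tight`); at composite `n` the conclusion is the input of Kneser's equality case / Kemperman's structure theorem
(tree: `Literature.Combinatorics.Additive.isAP_or_isQuasiPeriodic_add_of_card_add_le`, `kemperman_critical_pair`).  Example (§2): the last
residual pattern of order `46`, `{(2,2,3),(3,3,2),(3,3,2)}` (`12 + 18 + 18 = 48 > 46`), is tight in this sense at both `(3,3,2)` blocks:
`no_slack_card46_223_332_332_block1` records `|(−A₁) + (Y₀ ⊔ Y₂)| = 14` and `B₁ + V = H ∖ (Z₀ ⊔ Z₂)`.  The other five role readings follow by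
`stpp_rotate` / `isSTPP_neg_reverse` exactly as in the prime-order files.

References: M. Kneser, Math. Z. 58 (1953) (tree: `Literature.Combinatorics.Additive.add_kneser`); H. Cohn, R. Kleinberg, B. Szegedy, C. Umans, FOCS 2005
(arXiv:math/0511460), Def. 5.1.
-/

open Finset
open scoped Pointwise

namespace Summit.MatrixMultiplication.OmegaCensus.CubeNB

open Literature.Computability.AlgebraicComplexity
open Summit.MatrixMultiplication.OmegaCensus.STPPKneser

variable {H : Type*} [AddCommGroup H] [DecidableEq H] [Fintype H] {N : ℕ} {A B C : Fin N → Finset H}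

/-! ## §1 The tight-chain theorem -/

section Law

/-- **Critical pairs from a numerically tight N18 reading (any finite abelian group).**  See the module docstring: under the decidable
side condition on `(n, z, b, vol, a, L)`, the inner pair `(−Aᵢ, Y°)` has `|−Aᵢ + Y°| = a + L − 1`, the set `V = W ⊔ (−Aᵢ + Y°)` has
`vol + a + L − 1` elements, and `Bᵢ + V = H ∖ Z°` exactly. [cite: Kneser1953] [cite: CohnKleinbergSzegedyUmans2005, Def. 5.1] -/
theorem critical_of_n18_tight (hS : IsSTPP A B C) (hA : ∀ i, (A i).Nonempty) (hB : ∀ i, (B i).Nonempty)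
    (hC : ∀ i, (C i).Nonempty) (i : Fin N) (hI : (univ.erase i : Finset (Fin N)).Nonempty)
    {n : ℕ} (hn : Fintype.card H = n) {a b vol L z : ℕ} (ha : #(A i) = a) (hb : #(B i) = b)
    (hvol : #(A i) * #(B i) * #(C i) = vol) (hL : ∑ k ∈ univ.erase i, #(B k) * #(C k) = L)
    (hz : ∑ k ∈ univ.erase i, #(A k) * #(C k) = z)
    (hnum : ∀ d ∈ Nat.divisors n, ∀ d' ∈ Nat.divisors n, ∀ t < n + 1,
      kneserLB a L d' ≤ t → z + kneserLB b (vol + t) d ≤ n → t = a + L - 1 ∧ z + kneserLB b (vol + t) d = n) :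
    #((A i).image (fun x => (0 : H) - x) + DU B C (univ.erase i)) = a + L - 1 ∧
    #((((A i) ×ˢ ((B i) ×ˢ (C i))).image fun q : H × H × H => (0 : H) + q.2.2 - q.1 - q.2.1) ∪
        ((A i).image (fun x => (0 : H) - x) + DU B C (univ.erase i))) = vol + (a + L - 1) ∧
    B i + ((((A i) ×ˢ ((B i) ×ˢ (C i))).image fun q : H × H × H => (0 : H) + q.2.2 - q.1 - q.2.1) ∪
        ((A i).image (fun x => (0 : H) - x) + DU B C (univ.erase i))) = univ \ DU A C (univ.erase i) := by
  set W := ((A i) ×ˢ ((B i) ×ˢ (C i))).image fun q : H × H × H => (0 : H) + q.2.2 - q.1 - q.2.1 with hW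
  set S := (A i).image (fun x => (0 : H) - x) with hSdef
  set Yo := DU B C (univ.erase i) with hYo
  set Zo := DU A C (univ.erase i) with hZo
  have hWcard : #W = vol := by rw [hW, card_image_blockSum hS i 0]; exact hvol
  have hScard : #S = a := by rw [hSdef, Finset.card_image_of_injective _ (sub_right_injective), ha]
  have hYcard : #Yo = L := by rw [hYo, card_DU_BC hS hA _]; exact hL
  have hZcard : #Zo = z := by rw [hZo, card_DU_AC hS hB _]; exact hz
  have hSne : S.Nonempty := (hA i).image _
  have hYne : Yo.Nonempty := DU_nonempty hI hB hC
  have hWV : Disjoint W (S + Yo) := disjoint_W_negA_add_DU hS i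
  have hVcard : #(W ∪ (S + Yo)) = #W + #(S + Yo) := Finset.card_union_of_disjoint hWV
  have hVne : (W ∪ (S + Yo)).Nonempty := (hSne.add hYne).mono Finset.subset_union_right
  have hsub : B i + (W ∪ (S + Yo)) ⊆ univ \ Zo := B_add_W_union_negA_add_subset hS i
  have hn0 : n ≠ 0 := by rw [← hn]; exact Fintype.card_ne_zero
  -- cardinalities of the target and of the inner sum
  have hU : #(univ \ Zo) = n - z := by
    rw [Finset.card_sdiff_of_subset (Finset.subset_univ _), Finset.card_univ, hn, hZcard]
  have hzle : z ≤ n := by have h := Finset.card_le_univ Zo; rwa [hn, hZcard] at h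
  have htle : #(S + Yo) ≤ n := by have h := Finset.card_le_univ (S + Yo); rwa [hn] at h
  have hBV_le : #(B i + (W ∪ (S + Yo))) ≤ n - z := hU ▸ Finset.card_le_card hsub
  -- the two Kneser steps
  obtain ⟨d', hd', hdvd', hk'⟩ := exists_dvd_kneserLB_le_card_add S Yo hSne hYne
  obtain ⟨d, hd, hdvd, hk⟩ := exists_dvd_kneserLB_le_card_add (B i) (W ∪ (S + Yo)) (hB i) hVne
  rw [hScard, hYcard] at hk'
  rw [hb, hVcard, hWcard] at hk
  rw [hn] at hdvd hdvd'
  have hdm : d ∈ Nat.divisors n := Nat.mem_divisors.2 ⟨hdvd, hn0⟩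
  have hdm' : d' ∈ Nat.divisors n := Nat.mem_divisors.2 ⟨hdvd', hn0⟩
  obtain ⟨ht, hsum⟩ := hnum d hdm d' hdm' (#(S + Yo)) (Nat.lt_succ_of_le htle) hk' (by omega)
  refine ⟨ht, by rw [hVcard, hWcard, ht], ?_⟩
  apply Finset.eq_of_subset_of_card_le hsub
  rw [hU]
  omega

end Law

/-! ## §2 Example: the last residual pattern of order 46 is N18-tight at its `(3,3,2)` blocks -/

section Example

/-- **Order `46`, pattern `{(2,2,3),(3,3,2),(3,3,2)}`, `C`-reading at block `1`:** the inner pair `(−A₁, Y₀ ⊔ Y₂)` is critical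
(`|−A₁ + (Y₀ ⊔ Y₂)| = 3 + 12 − 1 = 14`), `|V| = 32`, and `B₁ + V = H ∖ (Z₀ ⊔ Z₂)` exactly (`3 + 32 − 1 = 34 = 46 − 12`); the numeric side
condition over the divisors `{1, 2, 23, 46}` is discharged by `decide`. [cite: Kneser1953] [cite: CohnKleinbergSzegedyUmans2005, Def. 5.1] -/
theorem no_slack_card46_223_332_332_block1 (hH : Fintype.card H = 46) (A B C : Fin 3 → Finset H) (hS : IsSTPP A B C)
    (hA : ∀ i, #(A i) = ![2, 3, 3] i) (hB : ∀ i, #(B i) = ![2, 3, 3] i) (hC : ∀ i, #(C i) = ![3, 2, 2] i) :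
    #((A 1).image (fun x => (0 : H) - x) + DU B C (univ.erase 1)) = 14 ∧
    #((((A 1) ×ˢ ((B 1) ×ˢ (C 1))).image fun q : H × H × H => (0 : H) + q.2.2 - q.1 - q.2.1) ∪
        ((A 1).image (fun x => (0 : H) - x) + DU B C (univ.erase 1))) = 32 ∧
    B 1 + ((((A 1) ×ˢ ((B 1) ×ˢ (C 1))).image fun q : H × H × H => (0 : H) + q.2.2 - q.1 - q.2.1) ∪
        ((A 1).image (fun x => (0 : H) - x) + DU B C (univ.erase 1))) = univ \ DU A C (univ.erase 1) := by
  have hAne : ∀ i, (A i).Nonempty := fun i => card_pos.1 (by rw [hA]; fin_cases i <;> simp)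
  have hBne : ∀ i, (B i).Nonempty := fun i => card_pos.1 (by rw [hB]; fin_cases i <;> simp)
  have hCne : ∀ i, (C i).Nonempty := fun i => card_pos.1 (by rw [hC]; fin_cases i <;> simp)
  have hsumL : ∑ k ∈ univ.erase (1 : Fin 3), #(B k) * #(C k) = 12 := by simp only [hB, hC]; decide
  have hsumz : ∑ k ∈ univ.erase (1 : Fin 3), #(A k) * #(C k) = 12 := by simp only [hA, hC]; decide
  exact critical_of_n18_tight hS hAne hBne hCne 1 ⟨0, by decide⟩ hH (a := 3) (b := 3) (vol := 18) (L := 12) (z := 12)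
    (by rw [hA]; rfl) (by rw [hB]; rfl) (by rw [hA, hB, hC]; rfl) hsumL hsumz (by decide)

end Example

/-! ## §3 The inner pair alone -/

section Inner

/-- **Inner critical pair from a numerically tight N18 reading** — the weaker side condition `… → t = a + L − 1` (no claim about the
outer sum) already gives `|(−Aᵢ) + Y°| = a + L − 1`.  Needed for the readings whose OUTER Kneser step is rescued with slack by a
non-trivial stabilizer (e.g. the `(B,C,A)` / `(A,C,B)` readings of `{(2,2,3),(3,3,2),(3,3,2)}` at order `46`, where `d = 2` gives `45 ≤ 46`).
[cite: Kneser1953] [cite: CohnKleinbergSzegedyUmans2005, Def. 5.1] -/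
theorem inner_critical_of_n18_tight (hS : IsSTPP A B C) (hA : ∀ i, (A i).Nonempty) (hB : ∀ i, (B i).Nonempty)
    (hC : ∀ i, (C i).Nonempty) (i : Fin N) (hI : (univ.erase i : Finset (Fin N)).Nonempty)
    {n : ℕ} (hn : Fintype.card H = n) {a b vol L z : ℕ} (ha : #(A i) = a) (hb : #(B i) = b)
    (hvol : #(A i) * #(B i) * #(C i) = vol) (hL : ∑ k ∈ univ.erase i, #(B k) * #(C k) = L)
    (hz : ∑ k ∈ univ.erase i, #(A k) * #(C k) = z)
    (hnum : ∀ d ∈ Nat.divisors n, ∀ d' ∈ Nat.divisors n, ∀ t < n + 1,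
      kneserLB a L d' ≤ t → z + kneserLB b (vol + t) d ≤ n → t = a + L - 1) :
    #((A i).image (fun x => (0 : H) - x) + DU B C (univ.erase i)) = a + L - 1 := by
  set W := ((A i) ×ˢ ((B i) ×ˢ (C i))).image fun q : H × H × H => (0 : H) + q.2.2 - q.1 - q.2.1 with hW
  set S := (A i).image (fun x => (0 : H) - x) with hSdef
  set Yo := DU B C (univ.erase i) with hYo
  set Zo := DU A C (univ.erase i) with hZo
  have hWcard : #W = vol := by rw [hW, card_image_blockSum hS i 0]; exact hvol
  have hScard : #S = a := by rw [hSdef, Finset.card_image_of_injective _ (sub_right_injective), ha]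
  have hYcard : #Yo = L := by rw [hYo, card_DU_BC hS hA _]; exact hL
  have hZcard : #Zo = z := by rw [hZo, card_DU_AC hS hB _]; exact hz
  have hSne : S.Nonempty := (hA i).image _
  have hYne : Yo.Nonempty := DU_nonempty hI hB hC
  have hWV : Disjoint W (S + Yo) := disjoint_W_negA_add_DU hS i
  have hVcard : #(W ∪ (S + Yo)) = #W + #(S + Yo) := Finset.card_union_of_disjoint hWV
  have hVne : (W ∪ (S + Yo)).Nonempty := (hSne.add hYne).mono Finset.subset_union_right
  have hsub : B i + (W ∪ (S + Yo)) ⊆ univ \ Zo := B_add_W_union_negA_add_subset hS i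
  have hn0 : n ≠ 0 := by rw [← hn]; exact Fintype.card_ne_zero
  have hU : #(univ \ Zo) = n - z := by
    rw [Finset.card_sdiff_of_subset (Finset.subset_univ _), Finset.card_univ, hn, hZcard]
  have hzle : z ≤ n := by have h := Finset.card_le_univ Zo; rwa [hn, hZcard] at h
  have htle : #(S + Yo) ≤ n := by have h := Finset.card_le_univ (S + Yo); rwa [hn] at h
  have hBV_le : #(B i + (W ∪ (S + Yo))) ≤ n - z := hU ▸ Finset.card_le_card hsub
  obtain ⟨d', hd', hdvd', hk'⟩ := exists_dvd_kneserLB_le_card_add S Yo hSne hYne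
  obtain ⟨d, hd, hdvd, hk⟩ := exists_dvd_kneserLB_le_card_add (B i) (W ∪ (S + Yo)) (hB i) hVne
  rw [hScard, hYcard] at hk'
  rw [hb, hVcard, hWcard] at hk
  rw [hn] at hdvd hdvd'
  have hdm : d ∈ Nat.divisors n := Nat.mem_divisors.2 ⟨hdvd, hn0⟩
  have hdm' : d' ∈ Nat.divisors n := Nat.mem_divisors.2 ⟨hdvd', hn0⟩
  exact hnum d hdm d' hdm' (#(S + Yo)) (Nat.lt_succ_of_le htle) hk' (by omega)

end Inner

end Summit.MatrixMultiplication.OmegaCensus.CubeNB
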